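import Mathlib.NumberTheory.FLT.Three
import HarnessLib

/-!
# The rational points of the plane model `s(s² + 9s + 27)(t² + 9t + 27) = t³` of `X₀(27)`

Trunk T-ELLARITH; topic `NumberTheory/EllipticCurves`, notion `modular_curves_rational_points`.
Serves the level-`27` entry of the Mazur–Kenku isogeny table (`Summit.ABC.ABC.Theses.*.MazurKenkuRadius`,
hypothesis `hT8` of `Summit.ABC.ABC.Theorems.mazurKenkuRadius_of_three`): an elliptic curve `E/ℚ` with a
rational cyclic `27`-isogeny `⟨P⟩` carries the two level-`9` Hauptmodul values
`t = η(E, ⟨3P⟩)` and `s = η(E/⟨9P⟩, ⟨P̄⟩)` of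
`Literature.NumberTheory.EllipticCurves.KleinFrickeLevelNine` (`WeierstrassCurve.exists_hauptmodul_nine_of_torsion`),
and these satisfy the degeneracy relation `s(s² + 9s + 27)(t² + 9t + 27) = t³` (both sides are the
level-`3` Hauptmodul of `(E/⟨9P⟩, ⟨3P̄⟩)`; in Maier's notation `t = t₉(τ)`, `s = t₉(3τ)`, and the relation
is `t₃(3τ) = t₉³/(t₉² + 9t₉ + 27)` combined with `t₃ = t₉(t₉² + 9t₉ + 27)`, which follow from the
eta products `t₉ = 3³[9]³/[1]³`, `t₃ = 3⁶[3]¹²/[1]¹²`, [cite: Maier2006, §5 (arXiv p. 20: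
`t₉² + 9t₉ + 27 = t₃/t₉ = 3³[3]¹²/([1]⁹[9]³)`) and Table 4 (N = 9)]). This file does the Diophantine
step only (it is proved in the tree, not cited).

## The result

* `XZeroTwentySeven.fermat_identity`: with `a = t(s + 3)`, `b = 3(t + 9)`, `c = (s + 3)(t + 9)` one has
  `a³ + b³ - c³ = -27 · (s(s² + 9s + 27)(t² + 9t + 27) - t³)` — the plane quintic is the Fermat cubic
  `A³ + B³ = C³` (`X₀(27)` is isomorphic to the Fermat cubic, conductor `27`).
* `XZeroTwentySeven.rat_point_eq`: for `s t : ℚ` with `t ≠ 0` on the curve, `(s, t) = (-3, -9)` — by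
  Euler's case `n = 3` of Fermat's Last Theorem (Mathlib's `fermatLastTheoremThree`) the only rational
  points of the Fermat cubic have `abc = 0`. The excluded point `(0, 0)` is the cusp `i∞`; `(-3, -9)` is
  the CM point (`j = (η+3)³(η³+9η²+27η+3)³/(η(η²+9η+27))` at `η = -9` is `-2¹⁵·3·5³`, the curves `27a2`,
  `27a4`), in accordance with `X₀(27)(ℚ) = {0, i∞, CM}` (Mazur–Vélu 1972; Ligozat 1975).

## References

* [Maier2006] R. S. Maier, On rationally parametrized modular equations, J. Ramanujan Math. Soc. 24
  (2009) 1–73, arXiv:math/0611041: Tables 2, 4 (Hauptmoduln `t_N`, level `9`).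
* Mathlib: `fermatLastTheoremThree : FermatLastTheoremFor 3`, `fermatLastTheoremFor_iff_rat`.
-/

namespace Literature.NumberTheory.EllipticCurves

/-- **The plane model of `X₀(27)` is the Fermat cubic**: with `a = t(s+3)`, `b = 3(t+9)`,
`c = (s+3)(t+9)`, `a³ + b³ - c³ = -27 (s(s²+9s+27)(t²+9t+27) - t³)`. [folklore] -/
theorem XZeroTwentySeven.fermat_identity {R : Type*} [CommRing R] (s t : R) :
    (t * (s + 3)) ^ 3 + (3 * (t + 9)) ^ 3 - ((s + 3) * (t + 9)) ^ 3 =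
      -27 * (s * (s ^ 2 + 9 * s + 27) * (t ^ 2 + 9 * t + 27) - t ^ 3) := by
  ring

/-- **Rational points of `s(s² + 9s + 27)(t² + 9t + 27) = t³`.** If `s t : ℚ`, `t ≠ 0` and
`s(s² + 9s + 27)(t² + 9t + 27) = t³`, then `s = -3` and `t = -9`: by `fermat_identity` the triple
`(t(s+3), 3(t+9), (s+3)(t+9))` solves `a³ + b³ = c³`, so by Fermat's Last Theorem for `n = 3`
(Euler; Mathlib `fermatLastTheoremThree`) one of `a, b, c` vanishes, and then all of them do.
(The other affine rational point `(0, 0)` of the quintic is the cusp.) [folklore] -/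
theorem XZeroTwentySeven.rat_point_eq {s t : ℚ} (ht : t ≠ 0)
    (h : s * (s ^ 2 + 9 * s + 27) * (t ^ 2 + 9 * t + 27) = t ^ 3) : s = -3 ∧ t = -9 := by
  have key : (t * (s + 3)) ^ 3 + (3 * (t + 9)) ^ 3 = ((s + 3) * (t + 9)) ^ 3 := by
    have e := XZeroTwentySeven.fermat_identity s t
    rw [h, sub_self, mul_zero, sub_eq_zero] at e
    exact e
  -- from `s = -3`: `27(t+9)³ = 0`; from `t = -9`: `(-9(s+3))³ = 0`
  have h₁ : s = -3 → t = -9 := fun hs => by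
    subst hs
    have e : (3 * (t + 9)) ^ 3 = 0 := by linear_combination key
    linear_combination (pow_eq_zero_iff (n := 3) (by norm_num)).1 e / 3
  have h₂ : t = -9 → s = -3 := fun ht' => by
    subst ht'
    have e : ((-9 : ℚ) * (s + 3)) ^ 3 = 0 := by linear_combination key
    linear_combination (pow_eq_zero_iff (n := 3) (by norm_num)).1 e / (-9)
  -- Fermat: one of `a, b, c` vanishes
  have h3 : t * (s + 3) = 0 ∨ 3 * (t + 9) = 0 ∨ (s + 3) * (t + 9) = 0 := by
    by_contra hne
    push Not at hne
    exact fermatLastTheoremFor_iff_rat.mp fermatLastTheoremThree _ _ _ hne.1 hne.2.1 hne.2.2 key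
  rcases h3 with h0 | h0 | h0
  · have hs : s = -3 := by
      have := (mul_eq_zero.1 h0).resolve_left ht
      linear_combination this
    exact ⟨hs, h₁ hs⟩
  · have ht' : t = -9 := by linear_combination h0 / 3
    exact ⟨h₂ ht', ht'⟩
  · rcases mul_eq_zero.1 h0 with h0 | h0
    · have hs : s = -3 := by linear_combination h0
      exact ⟨hs, h₁ hs⟩
    · have ht' : t = -9 := by linear_combination h0
      exact ⟨h₂ ht', ht'⟩

/-- The value of the level-`9` modular function `j = (η+3)³(η³+9η²+27η+3)³/(η(η²+9η+27))` at the CM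
point `η = -9` of `X₀(27)`: `j · (η(η²+9η+27)) = (η+3)³(η³+9η²+27η+3)³` forces `j = -2¹⁵·3·5³ =
-12288000` (the curves `27a2`, `27a4`, CM by the order of discriminant `-27`). [folklore] -/
theorem XZeroTwentySeven.j_eq_of_eta_eq {K : Type*} [Field K] [CharZero K] {j η : K} (hη : η = -9)
    (hj : j * (η * (η ^ 2 + 9 * η + 27)) = (η + 3) ^ 3 * (η ^ 3 + 9 * η ^ 2 + 27 * η + 3) ^ 3) :
    j = -12288000 := by
  subst hη
  have h243 : (243 : K) ≠ 0 := by norm_num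
  apply mul_right_cancel₀ h243
  linear_combination (-1 : K) * hj

end Literature.NumberTheory.EllipticCurves
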